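import Summits.ValiantsHypothesis.ValiantsHypothesis.Theorems.KPlusLogSqLawTridiagonalRealStaticUnitFiveExact

/-!
# Route «KPlusLogSqLaw», crux `WeakLifting` (stmt-ValiantsHypothesis-19561) — REAL side of the tridiagonal sector:
# the UNIT-COEFFICIENT sub-sector at size `5` — the SIDE LAW: zeros on both sides of the resonance force exactly one on each

HONEST FRAMING.  Helper theorems (`--supports stmt-ValiantsHypothesis-19561 --as helper`), seat val-sym-lift-p1 (g16), cell `pub-symmetroid`,
2026-08-28; companion of `…UnitFiveExact` (this seat: `U 5 = 4`, the fourth zero arising as THREE zeros on ONE side of `x = 1`) and `…UnitFive`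
(g15: outer-slope and anti-resonant laws).  Currency `StaticTridiagonalRealPotential.pathDet (fun _ => 1) d (fun _ => 1) f 5`; edge slopes
`L_t = 2f_t − d_t − d_{t+1}`; `x = 1` is always a zero at size `5`.  Proved here, for ALL exponent data (`unit_five_sides`):
**if a unit `5 × 5` design has determinant zeros on both sides of `x = 1`, it has exactly one on each side** — so the off-resonance
distribution `(Z₋, Z₊)` is one of `(0,0), (1,0), (0,1), (1,1), (2,0), (0,2), (3,0), (0,3)` (total `≤ 3` by `…UnitFiveExact`; `(3,0)` attained by
`L = (14, −51, −68, −16)`, `(2,0)` by `L = (20, 1, 5, −19)`), never `(2,1)` or `(1,2)`.  Mechanism, for `L₀ = a > 0 > L₃ = −e` (the mirror by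
reading the path backwards, `pathDet_unit_five_reverse`; `L₀L₃ ≥ 0` and `a = e` are the g15 laws):
* two ONE-SIDED regimes by pure monotonicity of integer powers: `L₂ + max(a,e) ≤ L₁` empties `(1,∞)` if `a < e` and `(0,1)` if `a > e`
  (`unit_five_noroot_gt_one_of_le`, `…_lt_one_of_le`), and `L₁ ≤ 0 ≤ L₂` empties `(0,1)` if `a < e` and `(1,∞)` if `a > e`
  (`unit_five_noroot_lt_one_of_sign`, `…_gt_one_of_sign`);
* everywhere else the deflated four-block polynomial of `…UnitFiveExact` has NO `(+,−,+)` coefficient triple — or, when `L₁, L₂ ≥ 1`, no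
  `(−,+,−)` triple (`unit_five_no_pmp`, `unit_five_no_mpm`: `omega` on the one-exponent bookkeeping of `…UnitFourBlock`) — hence `Var ≤ 2`
  (`signVariations_le_two_of_no_pmp` / `_mpm`, from the alternating-chain lemma) and at most two zeros off `x = 1`
  (`card_offres_le_two_of_eq_mul`).
The three-zero side of `…UnitFiveExact` is the regime `C = {L₁ ≤ −1, L₂+e+1 ≤ L₁, L₂+e+a ≤ −1, a−L₁ ≥ e+1}` (`a < e`) inside the first
one-sided regime.  Nothing here is an upper law for the register (α NO MOVER); nothing bears on `WeakLifting` / `TropicalB` (stmt-19771) in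
their windows, Conjecture B, the Door-A registers, `MatrixDescartes` (stmt-18050) or VP ≠ VNP.
[this seat; folklore: Descartes' rule of signs, monotonicity of integer powers]
-/

-- `Summit.ValiantsHypothesis.ValiantsHypothesis.…` repeats a component by the D-0017 layout (single-conjunct summit); the name is mandated.
set_option linter.dupNamespace false
set_option autoImplicit false

namespace Summit.ValiantsHypothesis.ValiantsHypothesis.Theorems.KPlusLogSqLaw
namespace StaticTridiagonalRealUnit

open Polynomial Finset
open Summit.ValiantsHypothesis.ValiantsHypothesis.Theorems.KPlusLogSqLaw.StaticTridiagonalRealPotential (pathDet)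

/-! ### 1. Descartes with `Var ≤ 2`: no `(+,−,+)` or no `(−,+,−)` coefficient triple -/

/-- a real polynomial with no coefficient triple of signs `(+,−,+)` at increasing exponents has `Var ≤ 2`. [this file] -/
theorem signVariations_le_two_of_no_pmp (R : ℝ[X])
    (h : ∀ i j k : ℕ, i < j → j < k → 0 < R.coeff i → R.coeff j < 0 → 0 < R.coeff k → False) :
    R.signVariations ≤ 2 := by
  by_contra h3
  have h3' : 3 ≤ R.signVariations := by omega
  have hR0 : R ≠ 0 := by rintro rfl; simp at h3'
  obtain ⟨idx, hmono, -, hsgn⟩ := exists_altChain_of_le_signVariations hR0 h3'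
  have hlc : R.leadingCoeff ≠ 0 := leadingCoeff_ne_zero.2 hR0
  have g0 := hsgn 0 (by norm_num)
  have g1 := hsgn 1 (by norm_num)
  have g2 := hsgn 2 (by norm_num)
  have g3 := hsgn 3 (by norm_num)
  simp only [pow_zero, one_mul, pow_one, neg_mul, neg_pos] at g0 g1 g2 g3
  have e2 : (-1 : ℝ) ^ 2 = 1 := by norm_num
  have e3 : (-1 : ℝ) ^ 3 = -1 := by norm_num
  rw [e2, one_mul] at g2
  rw [e3, neg_mul, one_mul, neg_pos] at g3
  rcases hlc.lt_or_gt with hl | hl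
  · have t1 : 0 < R.coeff (idx 1) := by nlinarith
    have t2 : R.coeff (idx 2) < 0 := by nlinarith
    have t3 : 0 < R.coeff (idx 3) := by nlinarith
    exact h _ _ _ (hmono 2 (by norm_num)) (hmono 1 (by norm_num)) t3 t2 t1
  · have t0 : 0 < R.coeff (idx 0) := by nlinarith
    have t1 : R.coeff (idx 1) < 0 := by nlinarith
    have t2 : 0 < R.coeff (idx 2) := by nlinarith
    exact h _ _ _ (hmono 1 (by norm_num)) (hmono 0 (by norm_num)) t2 t1 t0

/-- a real polynomial with no coefficient triple of signs `(−,+,−)` at increasing exponents has `Var ≤ 2`. [this file] -/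
theorem signVariations_le_two_of_no_mpm (R : ℝ[X])
    (h : ∀ i j k : ℕ, i < j → j < k → R.coeff i < 0 → 0 < R.coeff j → R.coeff k < 0 → False) :
    R.signVariations ≤ 2 := by
  rw [← signVariations_neg]
  refine signVariations_le_two_of_no_pmp (-R) fun i j k hij hjk hi hj hk => h i j k hij hjk ?_ ?_ ?_
  · simpa using hi
  · simpa using hj
  · simpa using hk

/-! ### 2. The deflated unit `5 × 5` determinant has no such triple outside two «one-sided» regimes -/

/-- block bookkeeping for the deflated determinant `X^{E₅}[e] − X^{E₆}[e] + X^{E₃}[a] − X^{E₇}[e]` of a unit design with `L₀ = a > 0 > L₃ = −e`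
(`E₆ = E₅ + a`, `E₃ = E₅ + L₂ + e`, `E₇ = E₅ + L₁`): outside the regimes `L₂ + max(a,e) ≤ L₁` and `L₁ ≤ 0 ≤ L₂`, and unless `L₁, L₂ ≥ 1`,
there is no `(+,−,+)` coefficient triple. [this file; `omega` on the one-exponent bookkeeping of `…UnitFourBlock`] -/
theorem unit_five_no_pmp (d f : ℕ → ℕ) (a e : ℕ) (h0 : 2 * f 0 = a + d 0 + d 1) (h3 : 2 * f 3 + e = d 3 + d 4)
    (hA : ¬ ((2 * f 2 : ℤ) - d 2 - d 3 + max (a : ℤ) e ≤ (2 * f 1 : ℤ) - d 1 - d 2))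
    (hB : ¬ ((2 * f 1 : ℤ) - d 1 - d 2 ≤ 0 ∧ 0 ≤ (2 * f 2 : ℤ) - d 2 - d 3))
    (hC : ¬ (1 ≤ (2 * f 1 : ℤ) - d 1 - d 2 ∧ 1 ≤ (2 * f 2 : ℤ) - d 2 - d 3))
    (i j k : ℕ) (hij : i < j) (hjk : j < k)
    (hi : (0 : ℝ) < (if d 0 + d 1 + d 2 + 2 * f 3 ≤ i ∧ i < d 0 + d 1 + d 2 + 2 * f 3 + e then (1 : ℝ) else 0) +
        (if d 0 + d 1 + 2 * f 2 + d 4 ≤ i ∧ i < d 0 + d 1 + 2 * f 2 + d 4 + a then (1 : ℝ) else 0) -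
        (if 2 * f 0 + d 2 + 2 * f 3 ≤ i ∧ i < 2 * f 0 + d 2 + 2 * f 3 + e then (1 : ℝ) else 0) -
        (if d 0 + 2 * f 1 + 2 * f 3 ≤ i ∧ i < d 0 + 2 * f 1 + 2 * f 3 + e then (1 : ℝ) else 0))
    (hj : (if d 0 + d 1 + d 2 + 2 * f 3 ≤ j ∧ j < d 0 + d 1 + d 2 + 2 * f 3 + e then (1 : ℝ) else 0) +
        (if d 0 + d 1 + 2 * f 2 + d 4 ≤ j ∧ j < d 0 + d 1 + 2 * f 2 + d 4 + a then (1 : ℝ) else 0) -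
        (if 2 * f 0 + d 2 + 2 * f 3 ≤ j ∧ j < 2 * f 0 + d 2 + 2 * f 3 + e then (1 : ℝ) else 0) -
        (if d 0 + 2 * f 1 + 2 * f 3 ≤ j ∧ j < d 0 + 2 * f 1 + 2 * f 3 + e then (1 : ℝ) else 0) < 0)
    (hk : (0 : ℝ) < (if d 0 + d 1 + d 2 + 2 * f 3 ≤ k ∧ k < d 0 + d 1 + d 2 + 2 * f 3 + e then (1 : ℝ) else 0) +
        (if d 0 + d 1 + 2 * f 2 + d 4 ≤ k ∧ k < d 0 + d 1 + 2 * f 2 + d 4 + a then (1 : ℝ) else 0) -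
        (if 2 * f 0 + d 2 + 2 * f 3 ≤ k ∧ k < 2 * f 0 + d 2 + 2 * f 3 + e then (1 : ℝ) else 0) -
        (if d 0 + 2 * f 1 + 2 * f 3 ≤ k ∧ k < d 0 + 2 * f 1 + 2 * f 3 + e then (1 : ℝ) else 0)) : False := by
  have Fi := fourBlock_pos_at hi
  have Fj := fourBlock_neg_at hj
  have Fk := fourBlock_pos_at hk
  rcases le_total (a : ℤ) e with hae | hae
  · rw [max_eq_right hae] at hA
    omega
  · rw [max_eq_left hae] at hA
    omega

/-- the companion: when `L₁, L₂ ≥ 1` (and `L₂ + max(a,e) ≤ L₁` fails) there is no `(−,+,−)` coefficient triple. [this file] -/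
theorem unit_five_no_mpm (d f : ℕ → ℕ) (a e : ℕ) (h0 : 2 * f 0 = a + d 0 + d 1) (h3 : 2 * f 3 + e = d 3 + d 4)
    (hA : ¬ ((2 * f 2 : ℤ) - d 2 - d 3 + max (a : ℤ) e ≤ (2 * f 1 : ℤ) - d 1 - d 2))
    (hC : 1 ≤ (2 * f 1 : ℤ) - d 1 - d 2 ∧ 1 ≤ (2 * f 2 : ℤ) - d 2 - d 3)
    (i j k : ℕ) (hij : i < j) (hjk : j < k)
    (hi : (if d 0 + d 1 + d 2 + 2 * f 3 ≤ i ∧ i < d 0 + d 1 + d 2 + 2 * f 3 + e then (1 : ℝ) else 0) +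
        (if d 0 + d 1 + 2 * f 2 + d 4 ≤ i ∧ i < d 0 + d 1 + 2 * f 2 + d 4 + a then (1 : ℝ) else 0) -
        (if 2 * f 0 + d 2 + 2 * f 3 ≤ i ∧ i < 2 * f 0 + d 2 + 2 * f 3 + e then (1 : ℝ) else 0) -
        (if d 0 + 2 * f 1 + 2 * f 3 ≤ i ∧ i < d 0 + 2 * f 1 + 2 * f 3 + e then (1 : ℝ) else 0) < 0)
    (hj : (0 : ℝ) < (if d 0 + d 1 + d 2 + 2 * f 3 ≤ j ∧ j < d 0 + d 1 + d 2 + 2 * f 3 + e then (1 : ℝ) else 0) +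
        (if d 0 + d 1 + 2 * f 2 + d 4 ≤ j ∧ j < d 0 + d 1 + 2 * f 2 + d 4 + a then (1 : ℝ) else 0) -
        (if 2 * f 0 + d 2 + 2 * f 3 ≤ j ∧ j < 2 * f 0 + d 2 + 2 * f 3 + e then (1 : ℝ) else 0) -
        (if d 0 + 2 * f 1 + 2 * f 3 ≤ j ∧ j < d 0 + 2 * f 1 + 2 * f 3 + e then (1 : ℝ) else 0))
    (hk : (if d 0 + d 1 + d 2 + 2 * f 3 ≤ k ∧ k < d 0 + d 1 + d 2 + 2 * f 3 + e then (1 : ℝ) else 0) +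
        (if d 0 + d 1 + 2 * f 2 + d 4 ≤ k ∧ k < d 0 + d 1 + 2 * f 2 + d 4 + a then (1 : ℝ) else 0) -
        (if 2 * f 0 + d 2 + 2 * f 3 ≤ k ∧ k < 2 * f 0 + d 2 + 2 * f 3 + e then (1 : ℝ) else 0) -
        (if d 0 + 2 * f 1 + 2 * f 3 ≤ k ∧ k < d 0 + 2 * f 1 + 2 * f 3 + e then (1 : ℝ) else 0) < 0) : False := by
  have Fi := fourBlock_neg_at hi
  have Fj := fourBlock_pos_at hj
  have Fk := fourBlock_neg_at hk
  rcases le_total (a : ℤ) e with hae | hae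
  · rw [max_eq_right hae] at hA
    omega
  · rw [max_eq_left hae] at hA
    omega

/-! ### 3. One-sided regimes: no zero above `1`, or no zero below `1` -/

/-- `L₀ > 0 > L₃`, `L₀ + L₃ < 0` (`a < e`) and `L₂ − L₃ ≤ L₁`: the root equation has no solution `x > 1`
(`x^{L₂}(x^{L₀} − 1) < x^{L₁}(1 − x^{L₃})`). [this file] -/
theorem unit_five_noroot_gt_one_of_le (L₀ L₁ L₂ L₃ : ℤ) (hL0 : 0 < L₀) (hL3 : L₃ < 0) (hae : L₀ + L₃ < 0)
    (hreg : L₂ - L₃ ≤ L₁) {x : ℝ} (hx : 1 < x)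
    (hr : (1 - x ^ L₀) * (1 - x ^ L₃) = x ^ L₁ * (1 - x ^ L₃) + x ^ L₂ * (1 - x ^ L₀)) : False := by
  have hx0 : 0 < x := one_pos.trans hx
  have hA : 1 < x ^ L₀ := one_lt_zpow₀ hx hL0
  have hB : x ^ L₃ < 1 := zpow_lt_one_of_neg₀ hx hL3
  have hB0 : 0 < x ^ L₃ := zpow_pos hx0 _
  have hP : 0 < x ^ L₁ := zpow_pos hx0 _
  have hR : 0 < x ^ L₂ := zpow_pos hx0 _
  have hAB : x ^ L₀ * x ^ L₃ < 1 := by rw [← zpow_add₀ hx0.ne']; exact zpow_lt_one_of_neg₀ hx hae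
  have h1 : x ^ L₂ ≤ x ^ L₁ * x ^ L₃ := by
    rw [← zpow_add₀ hx0.ne']; exact zpow_le_zpow_right₀ hx.le (by omega)
  have k1 : x ^ L₂ * (x ^ L₀ - 1) = x ^ L₁ * (1 - x ^ L₃) + (x ^ L₀ - 1) * (1 - x ^ L₃) := by linear_combination hr
  nlinarith [mul_le_mul_of_nonneg_right h1 (sub_pos.2 hB).le, mul_pos (sub_pos.2 hA) (sub_pos.2 hB),
    mul_pos hR (sub_pos.2 hAB)]

/-- `L₀ > 0 > L₃`, `L₀ + L₃ < 0` (`a < e`) and `L₁ ≤ 0 ≤ L₂`: the root equation has no solution `0 < x < 1`. [this file] -/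
theorem unit_five_noroot_lt_one_of_sign (L₀ L₁ L₂ L₃ : ℤ) (hL0 : 0 < L₀) (hL3 : L₃ < 0) (hae : L₀ + L₃ < 0)
    (h1 : L₁ ≤ 0) (h2 : 0 ≤ L₂) {x : ℝ} (hx0 : 0 < x) (hx : x < 1)
    (hr : (1 - x ^ L₀) * (1 - x ^ L₃) = x ^ L₁ * (1 - x ^ L₃) + x ^ L₂ * (1 - x ^ L₀)) : False := by
  have hA : x ^ L₀ < 1 := zpow_lt_one₀ hx0 hx hL0
  have hA0 : 0 < x ^ L₀ := zpow_pos hx0 _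
  have hB : 1 < x ^ L₃ := one_lt_zpow_of_neg₀ hx0 hx hL3
  have hP : 1 ≤ x ^ L₁ := one_le_zpow_of_nonpos₀ hx0 hx.le h1
  have hR : x ^ L₂ ≤ 1 := zpow_le_one₀ hx0 hx.le h2
  have hR0 : 0 < x ^ L₂ := zpow_pos hx0 _
  have hAB : 1 < x ^ L₀ * x ^ L₃ := by rw [← zpow_add₀ hx0.ne']; exact one_lt_zpow_of_neg₀ hx0 hx hae
  -- `(B − 1)(P + A − 1) = R(1 − A)` with `P + A − 1 ≥ A`, `R ≤ 1`, `AB > 1`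
  have k1 : (x ^ L₃ - 1) * (x ^ L₁ + x ^ L₀ - 1) = x ^ L₂ * (1 - x ^ L₀) := by linear_combination hr
  nlinarith [mul_le_mul_of_nonneg_left hP (sub_pos.2 hB).le, mul_le_mul_of_nonneg_right hR (sub_pos.2 hA).le]

/-- `L₀ > 0 > L₃`, `L₀ + L₃ > 0` (`a > e`) and `L₂ + L₀ ≤ L₁`: the root equation has no solution `0 < x < 1`. [this file] -/
theorem unit_five_noroot_lt_one_of_le (L₀ L₁ L₂ L₃ : ℤ) (hL0 : 0 < L₀) (hL3 : L₃ < 0) (hae : 0 < L₀ + L₃)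
    (hreg : L₂ + L₀ ≤ L₁) {x : ℝ} (hx0 : 0 < x) (hx : x < 1)
    (hr : (1 - x ^ L₀) * (1 - x ^ L₃) = x ^ L₁ * (1 - x ^ L₃) + x ^ L₂ * (1 - x ^ L₀)) : False := by
  have hA : x ^ L₀ < 1 := zpow_lt_one₀ hx0 hx hL0
  have hA0 : 0 < x ^ L₀ := zpow_pos hx0 _
  have hB : 1 < x ^ L₃ := one_lt_zpow_of_neg₀ hx0 hx hL3
  have hP : 0 < x ^ L₁ := zpow_pos hx0 _
  have hR0 : 0 < x ^ L₂ := zpow_pos hx0 _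
  have hAB : x ^ L₀ * x ^ L₃ < 1 := by rw [← zpow_add₀ hx0.ne']; exact zpow_lt_one₀ hx0 hx hae
  have h1 : x ^ L₁ ≤ x ^ L₂ * x ^ L₀ := by
    rw [← zpow_add₀ hx0.ne']; exact zpow_le_zpow_right_of_le_one₀ hx0 hx.le (by omega)
  -- `(1 − A)(B − 1 + R) = P(B − 1)` with `P ≤ R·A` and `AB < 1`
  have k1 : (1 - x ^ L₀) * (x ^ L₃ - 1 + x ^ L₂) = x ^ L₁ * (x ^ L₃ - 1) := by linear_combination -hr
  nlinarith [mul_le_mul_of_nonneg_right h1 (sub_pos.2 hB).le, mul_pos (sub_pos.2 hA) (sub_pos.2 hB),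
    mul_pos hR0 (sub_pos.2 hAB)]

/-- `L₀ > 0 > L₃`, `L₀ + L₃ > 0` (`a > e`) and `L₁ ≤ 0 ≤ L₂`: the root equation has no solution `x > 1`. [this file] -/
theorem unit_five_noroot_gt_one_of_sign (L₀ L₁ L₂ L₃ : ℤ) (hL0 : 0 < L₀) (hL3 : L₃ < 0) (hae : 0 < L₀ + L₃)
    (h1 : L₁ ≤ 0) (h2 : 0 ≤ L₂) {x : ℝ} (hx : 1 < x)
    (hr : (1 - x ^ L₀) * (1 - x ^ L₃) = x ^ L₁ * (1 - x ^ L₃) + x ^ L₂ * (1 - x ^ L₀)) : False := by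
  have hx0 : 0 < x := one_pos.trans hx
  have hA : 1 < x ^ L₀ := one_lt_zpow₀ hx hL0
  have hB : x ^ L₃ < 1 := zpow_lt_one_of_neg₀ hx hL3
  have hB0 : 0 < x ^ L₃ := zpow_pos hx0 _
  have hP : x ^ L₁ ≤ 1 := zpow_le_one_of_nonpos₀ hx.le h1
  have hP0 : 0 < x ^ L₁ := zpow_pos hx0 _
  have hR : 1 ≤ x ^ L₂ := one_le_zpow₀ hx.le h2
  have hAB : 1 < x ^ L₀ * x ^ L₃ := by rw [← zpow_add₀ hx0.ne']; exact one_lt_zpow₀ hx hae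
  -- `(A − 1)(R + B − 1) = P(1 − B)` with `R + B − 1 ≥ B`, `P ≤ 1`, `AB > 1`
  have k1 : (x ^ L₀ - 1) * (x ^ L₂ + x ^ L₃ - 1) = x ^ L₁ * (1 - x ^ L₃) := by linear_combination hr
  nlinarith [mul_le_mul_of_nonneg_left hR (sub_pos.2 hA).le, mul_le_mul_of_nonneg_right hP (sub_pos.2 hB).le]

/-! ### 4. Counting off the resonance zero, reversal symmetry, and the side law -/

/-- if `D = (X − 1)·R` with `Var R ≤ 2` then `D` has at most two distinct positive roots OFF `x = 1`. [this file] -/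
theorem card_offres_le_two_of_eq_mul (D R : ℝ[X]) (hD : D = (X - C 1) * R) (hV : R.signVariations ≤ 2) :
    (D.roots.toFinset.filter (fun x => 0 < x ∧ x ≠ 1)).card ≤ 2 := by
  by_cases hD0 : D = 0
  · rw [hD0, roots_zero]; simp
  have hR0 : R ≠ 0 := fun h => hD0 (by rw [hD, h, mul_zero])
  have hX1 : (X - C (1 : ℝ)) * R ≠ 0 := by rw [← hD]; exact hD0
  have hsub : D.roots.toFinset.filter (fun x => 0 < x ∧ x ≠ 1) ⊆ R.roots.toFinset.filter (fun x => 0 < x) := by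
    intro x hx
    simp only [Finset.mem_filter, Multiset.mem_toFinset] at hx ⊢
    rw [hD, roots_mul hX1, roots_X_sub_C, Multiset.mem_add, Multiset.mem_singleton] at hx
    rcases hx.1 with h1 | h1
    · exact absurd h1 hx.2.2
    · exact ⟨h1, hx.2.1⟩
  have hcount : R.roots.countP (fun x => 0 < x) ≤ 2 := R.roots_countP_pos_le_signVariations.trans hV
  have hcard : (R.roots.toFinset.filter (fun x => 0 < x)).card ≤ R.roots.countP (fun x => 0 < x) := by
    rw [← Multiset.toFinset_filter, Multiset.countP_eq_card_filter]
    exact Multiset.toFinset_card_le _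
  exact (Finset.card_le_card hsub).trans (hcard.trans hcount)

variable (d : ℕ → ℕ) (f : ℕ → ℕ)

/-- reversal symmetry of the path: reading the design backwards gives the same determinant. [folklore] -/
theorem pathDet_unit_five_reverse :
    pathDet (fun _ => (1 : ℝ)) d (fun _ => (1 : ℝ)) f 5 =
      pathDet (fun _ => (1 : ℝ)) (fun t => d (4 - t)) (fun _ => (1 : ℝ)) (fun t => f (3 - t)) 5 := by
  refine Polynomial.funext fun x => ?_
  rw [eval_unit_five, eval_unit_five]
  norm_num
  ring

/-- the side law in the orientation `L₀ > 0 > L₃`: if both sides of `x = 1` carry a zero then at most two zeros lie off `x = 1`. [this file] -/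
theorem card_offres_le_two_of_sides_aux (hL0 : 0 < (2 * f 0 : ℤ) - d 0 - d 1) (hL3 : (2 * f 3 : ℤ) - d 3 - d 4 < 0)
    (hlo : ∃ x : ℝ, 0 < x ∧ x < 1 ∧ (pathDet (fun _ => (1 : ℝ)) d (fun _ => (1 : ℝ)) f 5).eval x = 0)
    (hhi : ∃ x : ℝ, 1 < x ∧ (pathDet (fun _ => (1 : ℝ)) d (fun _ => (1 : ℝ)) f 5).eval x = 0) :
    ((pathDet (fun _ => (1 : ℝ)) d (fun _ => (1 : ℝ)) f 5).roots.toFinset.filter (fun x => 0 < x ∧ x ≠ 1)).card ≤ 2 := by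
  set L₀ : ℤ := (2 * f 0 : ℤ) - d 0 - d 1 with hL₀
  set L₁ : ℤ := (2 * f 1 : ℤ) - d 1 - d 2 with hL₁
  set L₂ : ℤ := (2 * f 2 : ℤ) - d 2 - d 3 with hL₂
  set L₃ : ℤ := (2 * f 3 : ℤ) - d 3 - d 4 with hL₃
  obtain ⟨y, hy0, hy1, hyr⟩ := hlo
  obtain ⟨z, hz1, hzr⟩ := hhi
  have hz0 : 0 < z := one_pos.trans hz1
  have ey := unit_five_root_eq d f hy0 hyr
  have ez := unit_five_root_eq d f hz0 hzr
  obtain ⟨a, ha⟩ : ∃ a : ℕ, L₀ = a := ⟨_, (Int.toNat_of_nonneg hL0.le).symm⟩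
  obtain ⟨e, he⟩ : ∃ e : ℕ, -L₃ = e := ⟨_, (Int.toNat_of_nonneg (by omega)).symm⟩
  -- the anti-resonant hyperplane `a = e`: `Z ≤ 3` with `x = 1` among the zeros
  by_cases hae : L₀ + L₃ = 0
  · have h3 := card_posRoots_unit_five_le_three_of_antiResonant d f hae
    by_cases hD : pathDet (fun _ => (1 : ℝ)) d (fun _ => (1 : ℝ)) f 5 = 0
    · rw [hD, roots_zero]; simp
    have hone : (1 : ℝ) ∈ (pathDet (fun _ => (1 : ℝ)) d (fun _ => (1 : ℝ)) f 5).roots.toFinset.filter (fun x => 0 < x) := by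
      simp only [Finset.mem_filter, Multiset.mem_toFinset, mem_roots', IsRoot.def]
      refine ⟨⟨hD, ?_⟩, one_pos⟩
      rw [eval_unit_five]; simp
    have hsub : (pathDet (fun _ => (1 : ℝ)) d (fun _ => (1 : ℝ)) f 5).roots.toFinset.filter (fun x => 0 < x ∧ x ≠ 1) ⊆
        ((pathDet (fun _ => (1 : ℝ)) d (fun _ => (1 : ℝ)) f 5).roots.toFinset.filter (fun x => 0 < x)).erase 1 := by
      intro x hx
      simp only [Finset.mem_filter, Finset.mem_erase] at hx ⊢
      exact ⟨hx.2.2, hx.1, hx.2.1⟩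
    have := Finset.card_le_card hsub
    rw [Finset.card_erase_of_mem hone] at this
    omega
  -- otherwise `a ≠ e`; three regimes
  by_cases hA : L₂ + max (a : ℤ) e ≤ L₁
  · exfalso
    rcases lt_or_gt_of_ne hae with hlt | hgt
    · exact unit_five_noroot_gt_one_of_le L₀ L₁ L₂ L₃ hL0 hL3 hlt
        (by have := le_max_right (a : ℤ) e; omega) hz1 ez
    · exact unit_five_noroot_lt_one_of_le L₀ L₁ L₂ L₃ hL0 hL3 hgt
        (by have := le_max_left (a : ℤ) e; omega) hy0 hy1 ey
  by_cases hB : L₁ ≤ 0 ∧ 0 ≤ L₂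
  · exfalso
    rcases lt_or_gt_of_ne hae with hlt | hgt
    · exact unit_five_noroot_lt_one_of_sign L₀ L₁ L₂ L₃ hL0 hL3 hlt hB.1 hB.2 hy0 hy1 ey
    · exact unit_five_noroot_gt_one_of_sign L₀ L₁ L₂ L₃ hL0 hL3 hgt hB.1 hB.2 hz1 ez
  -- the Descartes regime: the deflated four-block polynomial has `Var ≤ 2`
  have hfac := unit_five_eq_X_sub_one_mul d f a e (by omega) (by omega)
  refine card_offres_le_two_of_eq_mul _ _ hfac ?_
  by_cases hC : 1 ≤ L₁ ∧ 1 ≤ L₂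
  · refine signVariations_le_two_of_no_mpm _ fun i j k hij hjk hi hj hk => ?_
    rw [coeff_fourBlock] at hi hj hk
    exact unit_five_no_mpm d f a e (by omega) (by omega) hA hC i j k hij hjk hi hj hk
  · refine signVariations_le_two_of_no_pmp _ fun i j k hij hjk hi hj hk => ?_
    rw [coeff_fourBlock] at hi hj hk
    exact unit_five_no_pmp d f a e (by omega) (by omega) hA hB hC i j k hij hjk hi hj hk

/-- **SIDE LAW at size `5` (kernel, all exponents)**: if a unit-coefficient static symmetric tridiagonal `5 × 5` design has determinant zeros on BOTH
sides of the resonance `x = 1`, then it has exactly ONE on each side.  Equivalently the off-resonance zero distribution `(Z₋, Z₊)` lies in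
`{(0,0),(1,0),(0,1),(1,1),(2,0),(0,2),(3,0),(0,3)}` (with `…UnitFiveExact`: total `≤ 3`; `(3,0)` is attained by `L = (14,−51,−68,−16)`). [this file] -/
theorem unit_five_sides
    (hlo : (((pathDet (fun _ => (1 : ℝ)) d (fun _ => (1 : ℝ)) f 5).roots.toFinset.filter (fun x => 0 < x ∧ x < 1))).Nonempty)
    (hhi : (((pathDet (fun _ => (1 : ℝ)) d (fun _ => (1 : ℝ)) f 5).roots.toFinset.filter (fun x => 1 < x))).Nonempty) :
    ((pathDet (fun _ => (1 : ℝ)) d (fun _ => (1 : ℝ)) f 5).roots.toFinset.filter (fun x => 0 < x ∧ x < 1)).card = 1 ∧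
      ((pathDet (fun _ => (1 : ℝ)) d (fun _ => (1 : ℝ)) f 5).roots.toFinset.filter (fun x => 1 < x)).card = 1 := by
  set D := pathDet (fun _ => (1 : ℝ)) d (fun _ => (1 : ℝ)) f 5 with hDdef
  -- (1) the off-resonance set has at most two elements
  have key : (D.roots.toFinset.filter (fun x => 0 < x ∧ x ≠ 1)).card ≤ 2 := by
    obtain ⟨y, hy⟩ := hlo
    obtain ⟨z, hz⟩ := hhi
    simp only [Finset.mem_filter, Multiset.mem_toFinset, mem_roots', IsRoot.def] at hy hz
    have hlo' : ∃ x : ℝ, 0 < x ∧ x < 1 ∧ D.eval x = 0 := ⟨y, hy.2.1, hy.2.2, hy.1.2⟩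
    have hhi' : ∃ x : ℝ, 1 < x ∧ D.eval x = 0 := ⟨z, hz.2, hz.1.2⟩
    by_cases hout : 0 ≤ ((2 * f 0 : ℤ) - d 0 - d 1) * ((2 * f 3 : ℤ) - d 3 - d 4)
    · refine (Finset.card_le_card fun x hx => ?_).trans (card_posRoots_unit_five_le_two_of_outer d f hout)
      simp only [Finset.mem_filter] at hx ⊢
      exact ⟨hx.1, hx.2.1⟩
    rcases lt_or_ge 0 ((2 * f 0 : ℤ) - d 0 - d 1) with h0 | h0
    · have h3 : (2 * f 3 : ℤ) - d 3 - d 4 < 0 := by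
        by_contra h3; exact hout (mul_nonneg h0.le (not_lt.1 h3))
      exact card_offres_le_two_of_sides_aux d f h0 h3 hlo' hhi'
    · have h0' : (2 * f 0 : ℤ) - d 0 - d 1 < 0 := by
        rcases h0.lt_or_eq with h0 | h0
        · exact h0
        · exfalso; exact hout (by rw [h0, zero_mul])
      have h3 : 0 < (2 * f 3 : ℤ) - d 3 - d 4 := by
        by_contra h3; exact hout (mul_nonneg_of_nonpos_of_nonpos h0 (not_lt.1 h3))
      -- read the design backwards: `L₀' = L₃ > 0 > L₃' = L₀`, same determinant
      have hrev := pathDet_unit_five_reverse d f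
      rw [hDdef, hrev] at hlo' hhi' ⊢
      exact card_offres_le_two_of_sides_aux (fun t => d (4 - t)) (fun t => f (3 - t))
        (by show (0 : ℤ) < 2 * ((f 3 : ℕ) : ℤ) - ((d 4 : ℕ) : ℤ) - ((d 3 : ℕ) : ℤ); omega)
        (by show 2 * ((f 0 : ℕ) : ℤ) - ((d 1 : ℕ) : ℤ) - ((d 0 : ℕ) : ℤ) < 0; omega) hlo' hhi'
  -- (2) the two sides are disjoint parts of it, each non-empty
  have hsub : D.roots.toFinset.filter (fun x => 0 < x ∧ x < 1) ∪ D.roots.toFinset.filter (fun x => 1 < x) ⊆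
      D.roots.toFinset.filter (fun x => 0 < x ∧ x ≠ 1) := by
    intro x hx
    simp only [Finset.mem_union, Finset.mem_filter] at hx ⊢
    rcases hx with ⟨h1, h2, h3⟩ | ⟨h1, h2⟩
    · exact ⟨h1, h2, h3.ne⟩
    · exact ⟨h1, one_pos.trans h2, h2.ne'⟩
  have hdisj : Disjoint (D.roots.toFinset.filter (fun x => 0 < x ∧ x < 1)) (D.roots.toFinset.filter (fun x => 1 < x)) := by
    rw [Finset.disjoint_filter]
    intro x _ h1 h2
    exact absurd (h1.2.trans h2) (lt_irrefl _)
  have hsum := Finset.card_le_card hsub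
  rw [Finset.card_union_of_disjoint hdisj] at hsum
  have h1 := hlo.card_pos
  have h2 := hhi.card_pos
  omega

end StaticTridiagonalRealUnit
end Summit.ValiantsHypothesis.ValiantsHypothesis.Theorems.KPlusLogSqLaw
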